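/-
Copyright (c) 2026 the pub-hodgecm-mathlib formalisation cell (harness21).  Prover seat hodgecm-mathlib-K2E1-p09 (g4), Track B ∕ K2-LIT,
h413 = `stmt-HodgeConjecture-24833`, line `K2_E1_TraceFormulaBeta`, campaign RES-RANK-ONE, page «EIS-RANK-ONE», SPEC «EIS-R6» v2 §2′: «EIS-R6f-ii-prep» `K2E1IntertwiningAdjoint`,
file (II) = Mok's `U(J_N)` instance; DEAL K2E1-plan (g3) 2026-09-04T05:05:55Z, GO 05:10:15Z.
-/
import Summits.HodgeConjecture.HodgeConjecture.Theorems.K2E1IntertwiningAdjointEngine        -- ★ p857571 (this seat): the generic engine (E1)–(E5)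
import Summits.HodgeConjecture.HodgeConjecture.Theorems.K2E1IntertwinedSectionInvariance     -- ★ p857500 (this seat): `map_conj_toAdelic_eq_self_three ∕ _two` (product formula), dictionary imports
import Literature.NumberTheory.Automorphic.UnitaryGroupBorelCosetSumUnfoldingBochnerFin      -- ★ the `B(F)♯`-covering-weight token `IsCoveringWeight ((arithmeticBorel F E c N).map (arithmeticSubgroup).subtype) β`
import Literature.NumberTheory.Automorphic.UnitaryGroupRankOneBigCell                        -- ★ `weylLongU_mul_weylLongU` (`w₀² = 1`, N = 3)
import Literature.NumberTheory.Automorphic.UnitaryTwoCartanAnyInvolution                     -- ★ `antidiagonal_two_over_eq` (for `w₀² = 1`, N = 2)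
import HarnessLib

/-!
# h413 ∕ Track B «K2-LIT», page EIS-RANK-ONE — `K2E1IntertwiningAdjoint`: **`⟨M_w h, f'⟩_B = ⟨h, M_{w⁻¹} f'⟩_B`** on Mok's `U(J_N)(𝔸_F)`, `w = ι(J_N)`, in the `B(F)♯`-weight currency of
# ★ `UnitaryGroupBorelCosetSumUnfoldingBochnerFin`, and the unfolded middle form `= ∫ wt B_β • (h(ι(J_N) g) · conj f'(g)) dν_G`

Cell `pub/hodgecm-mathlib`, crux H413 = `stmt-HodgeConjecture-24833`, route `HCCMUnconditional`; dealer K2E1-plan (g3).  THEOREMS ONLY (no `def`, no `instance`, no `notation`, no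
named-fact hypothesis, no `sorry`); lane `--kind proof --supports stmt-HodgeConjecture-24833 --as helper` (count-neutral).

LETTERS.  `G = (quasiSplit F E c N).Adelic`, `ι = toAdelic`, `J_N = (StdForm.antidiagonal N).over E`, `σ = (c : E →+* E)`; `N(𝔸) = adelicUnipotent F E c N` with a Haar measure `ν_N`
(inversion-invariant — `N(𝔸)` is unimodular); `Γ_T := (torusU σ J_N).map ι` («`T(F)♯`»), `Γ_N := rationalUnipotent F E c N` (`N(F)` inside `N(𝔸)`), `Γ_B := (arithmeticBorel F E c N).map
(arithmeticSubgroup).subtype` («`B(F)♯`», BochnerFin's token); `⟨Ψ₁, Ψ₂⟩_B := ∫ g, wt β g • (Ψ₁ g * conj (Ψ₂ g)) ∂ν_G` for an `IsCoveringWeight Γ_B β`; `M_w h (g) := ∫ v, h (w * ↑v * g) ∂ν_N`.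

* §1 `Γ_B = Γ_T ⋉ Γ_N`: the equivalence `e : Γ_T × Γ_N ≃ Γ_B`, `e(t, n) = t n` (★ `borelTriple` Levi projection, ★ `toAdelic_injective_quasiSplit`); membership lemmas; `w₀² = 1` at `N = 2`.
* §2 N-GENERIC ADJOINTNESS under the two rank-specific inputs as hypotheses — `hweyl : w₀ T(F) w₀⁻¹ ⊆ T(F)` (★ `weylConj_mem_torusU` ∕ `weylConj_mem_two`), `hww : w₀² = 1`, `hconj : ∀ b₀ ∈ B(F),
  (v ↦ ι b₀⁻¹ v ι b₀)_* ν_N = ν_N` (★ p857500, product formula) — **`integral_wt_smul_intertwining_mul_conj_eq_of`** and the middle form **`…_eq_integral_fibreWeight_of`** (dealer's ask (a)).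
* §3 the `U(J₃)` (`c² = 1`, `c ≠ 1`) and `U(J₂)` instances.

HONEST LABEL.  Count-neutral helper; proves no printed statement; HC_CM is proved only modulo the 7 printed citations (2 remaining named inputs: hLiu418 =
`stmt-HodgeConjecture-24832`, h413 = `stmt-HodgeConjecture-24833`) until rung 0 closes.

## References
* [MoeglinWaldspurger1995] C. Mœglin, J.-L. Waldspurger, *Spectral decomposition and Eisenstein series* (1995), II.1.6–II.1.8, IV.2.
* [Garrett2018] P. Garrett, *Modern Analysis of Automorphic Forms by Example* 1 (2018), §1.10–§1.11.
* [Arthur1980TraceFormulaII] J. Arthur, *A trace formula for reductive groups II*, Compositio Math. 40 (1980), §4.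
-/

set_option autoImplicit false
set_option linter.dupNamespace false  -- the mandated namespace repeats the summit's segment (`HodgeConjecture.HodgeConjecture`)

noncomputable section
open MeasureTheory Measure Set Filter Function NumberField IsDedekindDomain Matrix Literature.MeasureTheory.Group
open Literature.NumberTheory.Automorphic Literature.NumberTheory.Automorphic.UnitaryGroup AdelicGroupData
open Summit.HodgeConjecture.HodgeConjecture.Cruxes.H413.K2E1PseudoEisensteinConstantTermU
open Summit.HodgeConjecture.HodgeConjecture.Cruxes.H413.K2E1BorelCosetsDictionary
open Summit.HodgeConjecture.HodgeConjecture.Cruxes.H413.K2E1IntertwinedSectionInvariance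
open Summit.HodgeConjecture.HodgeConjecture.Cruxes.H413.K2E1IntertwiningAdjointEngine
open scoped ENNReal NNReal MatrixGroups

namespace Summit.HodgeConjecture.HodgeConjecture.Cruxes.H413.K2E1IntertwiningAdjoint

variable {F E : Type} [Field F] [NumberField F] [Field E] [NumberField E] [Algebra F E] {c : E ≃ₐ[F] E} {N : ℕ}

/-! ## §1 `Γ_B = Γ_T ⋉ Γ_N`: membership and the equivalence -/

section Letters

/-- Membership in `Γ_B = B(F)♯`: `x = ι b₀` with `b₀ ∈ B(F)`. [cite: Garrett2018, §1.10] -/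
theorem mem_mapBorel_iff {x : (quasiSplit F E c N).Adelic} :
    x ∈ (arithmeticBorel F E c N).map (quasiSplit F E c N).arithmeticSubgroup.subtype ↔
      ∃ b₀ ∈ borelU (c : E →+* E) ((StdForm.antidiagonal N).over E), (quasiSplit F E c N).toAdelic b₀ = x := by
  rw [Subgroup.mem_map]
  constructor
  · rintro ⟨γ, hγ, rfl⟩
    obtain ⟨b₀, hb₀⟩ := MonoidHom.mem_range.1 γ.2
    exact ⟨b₀, (mem_arithmeticBorel_iff_of_toAdelic_eq hb₀).1 hγ, hb₀⟩
  · rintro ⟨b₀, hb₀, rfl⟩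
    exact ⟨⟨(quasiSplit F E c N).toAdelic b₀, b₀, rfl⟩, (mem_arithmeticBorel_iff_of_toAdelic_eq rfl).2 hb₀, rfl⟩

/-- Membership in `Γ_T = T(F)♯`: `x = ι t₀` with `t₀ ∈ T(F)`. [cite: Garrett2018, §1.10] -/
theorem mem_mapTorus_iff {x : (quasiSplit F E c N).Adelic} :
    x ∈ (torusU (c : E →+* E) ((StdForm.antidiagonal N).over E)).map (quasiSplit F E c N).toAdelic ↔
      ∃ t₀ ∈ torusU (c : E →+* E) ((StdForm.antidiagonal N).over E), (quasiSplit F E c N).toAdelic t₀ = x :=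
  Subgroup.mem_map

/-- Membership in `Γ_N = N(F)`: `↑n = ι n₀` with `n₀ ∈ N_U(F)`. [cite: Garrett2018, §1.10] -/
theorem exists_eq_toAdelic_of_mem_rationalUnipotent (n : ↥(rationalUnipotent F E c N)) :
    ∃ n₀ ∈ unipotentU (c : E →+* E) ((StdForm.antidiagonal N).over E), (quasiSplit F E c N).toAdelic n₀ = ((n : ↥(adelicUnipotent F E c N)) : (quasiSplit F E c N).Adelic) := by
  obtain ⟨n₀, hn₀⟩ := (UnitaryGroup.mem_rationalUnipotent_iff _).1 n.2
  have hn₀' : (quasiSplit F E c N).toAdelic n₀ = ((n : ↥(adelicUnipotent F E c N)) : (quasiSplit F E c N).Adelic) := hn₀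
  refine ⟨n₀, (toAdelic_mem_adelicUnipotent_iff n₀).1 ?_, hn₀'⟩
  rw [hn₀']; exact (n : ↥(adelicUnipotent F E c N)).2

/-- `Γ_T ≤ G(F)` — hence `Γ_T` is countable. [cite: Garrett2018, §1.10] -/
theorem countable_mapTorus : Countable ↥((torusU (c : E →+* E) ((StdForm.antidiagonal N).over E)).map (quasiSplit F E c N).toAdelic) := by
  haveI : Countable (quasiSplit F E c N).arithmeticSubgroup := by rw [← quotientSubgroup_quasiSplit]; exact countable_quotientSubgroup_quasiSplit
  have hle : (torusU (c : E →+* E) ((StdForm.antidiagonal N).over E)).map (quasiSplit F E c N).toAdelic ≤ (quasiSplit F E c N).arithmeticSubgroup :=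
    Subgroup.map_le_range _ _
  exact (Subgroup.inclusion_injective hle).countable

/-- `Γ_N` is countable (it injects into `G(F)`). [cite: Garrett2018, §1.10] -/
theorem countable_rationalUnipotent' : Countable ↥(rationalUnipotent F E c N) := by
  haveI : Countable (quasiSplit F E c N).arithmeticSubgroup := by rw [← quotientSubgroup_quasiSplit]; exact countable_quotientSubgroup_quasiSplit
  have hinj : Function.Injective fun n : ↥(rationalUnipotent F E c N) =>
      (⟨((n : ↥(adelicUnipotent F E c N)) : (quasiSplit F E c N).Adelic), n.2⟩ : (quasiSplit F E c N).arithmeticSubgroup) :=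
    fun a b h => Subtype.ext (Subtype.ext (congrArg (fun z : (quasiSplit F E c N).arithmeticSubgroup => (z : (quasiSplit F E c N).Adelic)) h))
  exact hinj.countable

/-- **`Γ_B = Γ_T ⋉ Γ_N`**: an equivalence `e : Γ_T × Γ_N ≃ Γ_B` with `e(t, n) = t · n` — existence by the Levi projection of ★ `borelTriple` (`b₀ = t₀ n₀`), uniqueness by `T ∩ N_U = 1`
(★ `ParabolicTriple.eq_one_of_mem_of_mem`) and ★ `toAdelic_injective_quasiSplit`. [cite: Garrett2018, §1.10] [cite: MoeglinWaldspurger1995, I.1.4] -/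
theorem exists_equiv_torus_prod_rationalUnipotent :
    ∃ e : ↥((torusU (c : E →+* E) ((StdForm.antidiagonal N).over E)).map (quasiSplit F E c N).toAdelic) × ↥(rationalUnipotent F E c N) ≃
        ↥((arithmeticBorel F E c N).map (quasiSplit F E c N).arithmeticSubgroup.subtype),
      ∀ t n, ((e (t, n) : ↥((arithmeticBorel F E c N).map (quasiSplit F E c N).arithmeticSubgroup.subtype)) : (quasiSplit F E c N).Adelic) =
        (t : (quasiSplit F E c N).Adelic) * ((n : ↥(adelicUnipotent F E c N)) : (quasiSplit F E c N).Adelic) := by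
  -- the product map lands in `Γ_B`
  have hmem : ∀ (t : ↥((torusU (c : E →+* E) ((StdForm.antidiagonal N).over E)).map (quasiSplit F E c N).toAdelic)) (n : ↥(rationalUnipotent F E c N)),
      (t : (quasiSplit F E c N).Adelic) * ((n : ↥(adelicUnipotent F E c N)) : (quasiSplit F E c N).Adelic) ∈
        (arithmeticBorel F E c N).map (quasiSplit F E c N).arithmeticSubgroup.subtype := fun t n => by
    obtain ⟨t₀, ht₀, ht⟩ := mem_mapTorus_iff.1 t.2
    obtain ⟨n₀, hn₀, hn⟩ := exists_eq_toAdelic_of_mem_rationalUnipotent n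
    rw [mem_mapBorel_iff]
    refine ⟨t₀ * n₀, Subgroup.mul_mem _ (torusU_le_borelU _ _ ht₀) (unipotentU_le_borelU _ _ hn₀), ?_⟩
    rw [toAdelic_mul_quasiSplit, ht, hn]
  let f : ↥((torusU (c : E →+* E) ((StdForm.antidiagonal N).over E)).map (quasiSplit F E c N).toAdelic) × ↥(rationalUnipotent F E c N) →
      ↥((arithmeticBorel F E c N).map (quasiSplit F E c N).arithmeticSubgroup.subtype) := fun p => ⟨_, hmem p.1 p.2⟩
  have hf : ∀ t n, ((f (t, n) : ↥((arithmeticBorel F E c N).map (quasiSplit F E c N).arithmeticSubgroup.subtype)) : (quasiSplit F E c N).Adelic) =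
      (t : (quasiSplit F E c N).Adelic) * ((n : ↥(adelicUnipotent F E c N)) : (quasiSplit F E c N).Adelic) := fun _ _ => rfl
  refine ⟨Equiv.ofBijective f ⟨fun p q hpq => ?_, fun b => ?_⟩, fun t n => hf t n⟩
  · -- injectivity: `t n = t' n'` forces `t₀ = t₀'` and `n₀ = n₀'` (`T ∩ N_U = 1`)
    obtain ⟨t, n⟩ := p
    obtain ⟨t', n'⟩ := q
    have h : (t : (quasiSplit F E c N).Adelic) * ((n : ↥(adelicUnipotent F E c N)) : (quasiSplit F E c N).Adelic) =
        (t' : (quasiSplit F E c N).Adelic) * ((n' : ↥(adelicUnipotent F E c N)) : (quasiSplit F E c N).Adelic) := by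
      rw [← hf, ← hf]; exact congrArg Subtype.val hpq
    obtain ⟨t₀, ht₀, ht⟩ := mem_mapTorus_iff.1 t.2
    obtain ⟨n₀, hn₀, hn⟩ := exists_eq_toAdelic_of_mem_rationalUnipotent n
    obtain ⟨t₀', ht₀', ht'⟩ := mem_mapTorus_iff.1 t'.2
    obtain ⟨n₀', hn₀', hn'⟩ := exists_eq_toAdelic_of_mem_rationalUnipotent n'
    rw [← ht, ← hn, ← ht', ← hn', ← toAdelic_mul_quasiSplit, ← toAdelic_mul_quasiSplit] at h
    have h0 := toAdelic_injective_quasiSplit h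
    have hx : t₀'⁻¹ * t₀ = n₀' * n₀⁻¹ :=
      calc t₀'⁻¹ * t₀ = t₀'⁻¹ * (t₀ * n₀) * n₀⁻¹ := by group
        _ = t₀'⁻¹ * (t₀' * n₀') * n₀⁻¹ := by rw [h0]
        _ = n₀' * n₀⁻¹ := by group
    have h1 : t₀'⁻¹ * t₀ = 1 :=
      (borelTriple (c : E →+* E) ((StdForm.antidiagonal N).over E) rfl).eq_one_of_mem_of_mem
        (Subgroup.mul_mem _ (Subgroup.inv_mem _ ht₀') ht₀) (by rw [hx]; exact Subgroup.mul_mem _ hn₀' (Subgroup.inv_mem _ hn₀))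
    have ht₀eq : t₀ = t₀' := (inv_mul_eq_one.1 h1).symm
    have hn₀eq : n₀' = n₀ := mul_inv_eq_one.1 (hx ▸ h1)
    refine Prod.ext (Subtype.ext ?_) (Subtype.ext (Subtype.ext ?_))
    · rw [← ht, ← ht', ht₀eq]
    · change ((n : ↥(adelicUnipotent F E c N)) : (quasiSplit F E c N).Adelic) = ((n' : ↥(adelicUnipotent F E c N)) : (quasiSplit F E c N).Adelic)
      rw [← hn, ← hn', hn₀eq]
  · -- surjectivity: `b = ι b₀ = ι t₀ · ι n₀` with `t₀ = proj b₀`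
    obtain ⟨b₀, hb₀, hb⟩ := mem_mapBorel_iff.1 b.2
    set t₀ : ↥(torusU (c : E →+* E) ((StdForm.antidiagonal N).over E)) :=
      (borelTriple (c : E →+* E) ((StdForm.antidiagonal N).over E) rfl).proj ⟨b₀, hb₀⟩ with ht₀
    have hn₀ : (t₀ : ↥(unitaryGroupOfForm (c : E →+* E) ((StdForm.antidiagonal N).over E)))⁻¹ * b₀ ∈ unipotentU (c : E →+* E) ((StdForm.antidiagonal N).over E) :=
      (borelTriple (c : E →+* E) ((StdForm.antidiagonal N).over E) rfl).proj_inv_mul_mem ⟨b₀, hb₀⟩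
    let t : ↥((torusU (c : E →+* E) ((StdForm.antidiagonal N).over E)).map (quasiSplit F E c N).toAdelic) :=
      ⟨(quasiSplit F E c N).toAdelic (t₀ : ↥(unitaryGroupOfForm (c : E →+* E) ((StdForm.antidiagonal N).over E))), Subgroup.mem_map.2 ⟨_, t₀.2, rfl⟩⟩
    have hnA : (quasiSplit F E c N).toAdelic ((t₀ : ↥(unitaryGroupOfForm (c : E →+* E) ((StdForm.antidiagonal N).over E)))⁻¹ * b₀) ∈ adelicUnipotent F E c N :=
      (toAdelic_mem_adelicUnipotent_iff _).2 hn₀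
    let n : ↥(rationalUnipotent F E c N) := ⟨⟨_, hnA⟩, (UnitaryGroup.mem_rationalUnipotent_iff _).2 ⟨_, rfl⟩⟩
    refine ⟨(t, n), Subtype.ext ?_⟩
    rw [hf]
    change (quasiSplit F E c N).toAdelic (t₀ : ↥(unitaryGroupOfForm (c : E →+* E) ((StdForm.antidiagonal N).over E))) *
      (quasiSplit F E c N).toAdelic ((t₀ : ↥(unitaryGroupOfForm (c : E →+* E) ((StdForm.antidiagonal N).over E)))⁻¹ * b₀) = (b : (quasiSplit F E c N).Adelic)
    rw [← toAdelic_mul_quasiSplit, mul_inv_cancel_left, hb]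

omit [NumberField F] [NumberField E] [Algebra F E] in
/-- `w₀² = 1` in `U(J₂)` (`J₂² = 1`; the `N = 3` case is ★ `weylLongU_mul_weylLongU`). [cite: Rogawski1990, §1.10] -/
theorem weylLongU_mul_weylLongU_two (σ : E →+* E) :
    weylLongU σ (rfl : (StdForm.antidiagonal 2).over E = (StdForm.antidiagonal 2).over E) * weylLongU σ rfl = 1 := by
  apply Subtype.ext
  apply Units.ext
  change (((weylLongU σ (rfl : (StdForm.antidiagonal 2).over E = (StdForm.antidiagonal 2).over E) : ↥(unitaryGroupOfForm σ ((StdForm.antidiagonal 2).over E))) :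
      GL (Fin 2) E) : Matrix (Fin 2) (Fin 2) E) * (((weylLongU σ (rfl : (StdForm.antidiagonal 2).over E = (StdForm.antidiagonal 2).over E) :
      ↥(unitaryGroupOfForm σ ((StdForm.antidiagonal 2).over E))) : GL (Fin 2) E) : Matrix (Fin 2) (Fin 2) E) = 1
  rw [coe_coe_weylLongU, Two.antidiagonal_two_over_eq]
  ext i j
  fin_cases i <;> fin_cases j <;> simp [Matrix.mul_apply, Fin.sum_univ_two]

/-- `N(𝔸_F)` is closed in `G(𝔸_F)` (preimage of the closed upper-unitriangular group; local copy of the standard argument). [folklore] -/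
private theorem isClosed_adelicUnipotent' : IsClosed ((adelicUnipotent F E c N : Set (quasiSplit F E c N).Adelic)) := by
  haveI := t2Space_adeleRing_of_numberField E
  change IsClosed (⇑(adelicVal F E c N ((StdForm.antidiagonal N).over E)) ⁻¹'
    ((upperUnitriangular (Fin N) (AdeleRing (𝓞 E) E) : Subgroup (GL (Fin N) (AdeleRing (𝓞 E) E))) : Set (GL (Fin N) (AdeleRing (𝓞 E) E))))
  exact (isClosed_upperUnitriangular (R := AdeleRing (𝓞 E) E)).preimage continuous_subtype_val

end Letters

/-! ## §2 The adjointness on `U(J_N)(𝔸_F)`, N-generic under the three rank-specific inputs -/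

section Adjoint

variable [MeasurableSpace (quasiSplit F E c N).Adelic] [BorelSpace (quasiSplit F E c N).Adelic]

/-- **ADJOINTNESS OF THE INTERTWINING INTEGRAL ON `U(J_N)(𝔸_F)`** (N-generic form).  Inputs: Haar measures `ν_G` on `G(𝔸)` and `ν_N` on `N(𝔸)` (the latter inversion-invariant), a
fundamental domain `𝓕` of `N(F)` in `N(𝔸)` (`0 < ν_N(𝓕) < ∞`), a `B(F)♯`-covering weight `β` (BochnerFin token), the Weyl datum `w₀` with `w₀ T(F) w₀⁻¹ ⊆ T(F)` (`hweyl`) and `w₀² = 1`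
(`hww`), the product formula «conjugation by `B(F)` preserves `ν_N`» (`hconj`, ★ p857500), and measurable `h, f'` left-invariant under `N(𝔸)` and under `B(F)`, with the two
absolute-convergence hypotheses.  THEN `⟨M_{ι w₀} h, f'⟩_B = ⟨h, M_{ι w₀⁻¹} f'⟩_B`. (★ engine (E5) with `Γ_T = T(F)♯`, `Γ_N = N(F)`, `V = ν_N(𝓕)` by (E2).)
[cite: MoeglinWaldspurger1995, II.1.8] [cite: Garrett2018, §1.10–§1.11] [cite: Arthur1980TraceFormulaII, §4] -/
theorem integral_wt_smul_intertwining_mul_conj_eq_of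
    (νG : Measure (quasiSplit F E c N).Adelic) [νG.IsHaarMeasure] (νN : Measure ↥(adelicUnipotent F E c N)) [νN.IsHaarMeasure] [νN.IsInvInvariant]
    (hweyl : ∀ t₀ ∈ torusU (c : E →+* E) ((StdForm.antidiagonal N).over E),
      weylLongU (c : E →+* E) (rfl : (StdForm.antidiagonal N).over E = (StdForm.antidiagonal N).over E) * t₀ * (weylLongU (c : E →+* E) rfl)⁻¹ ∈
        torusU (c : E →+* E) ((StdForm.antidiagonal N).over E))
    (hww : weylLongU (c : E →+* E) (rfl : (StdForm.antidiagonal N).over E = (StdForm.antidiagonal N).over E) * weylLongU (c : E →+* E) rfl = 1)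
    (hconj : ∀ b₀ (hb₀ : b₀ ∈ borelU (c : E →+* E) ((StdForm.antidiagonal N).over E)),
      νN.map (fun v : ↥(adelicUnipotent F E c N) => (⟨((quasiSplit F E c N).toAdelic b₀)⁻¹ * (v : (quasiSplit F E c N).Adelic) * (quasiSplit F E c N).toAdelic b₀,
        conj_mem_adelicUnipotent ((K2E1PseudoEisensteinConstantTermU.toAdelic_mem_borelAdelic_iff b₀).2 hb₀) v.2⟩ : ↥(adelicUnipotent F E c N))) = νN)
    {β : (quasiSplit F E c N).Adelic → ℝ≥0∞} (hβ : IsCoveringWeight ↥((arithmeticBorel F E c N).map (quasiSplit F E c N).arithmeticSubgroup.subtype) β)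
    {𝓕 : Set ↥(adelicUnipotent F E c N)} (h𝓕 : IsFundamentalDomain ↥(rationalUnipotent F E c N) 𝓕 νN) (h𝓕₀ : νN 𝓕 ≠ 0) (h𝓕top : νN 𝓕 ≠ ∞)
    {h f' : (quasiSplit F E c N).Adelic → ℂ} (hhm : Measurable h) (hf'm : Measurable f')
    (hhN : ∀ (u : ↥(adelicUnipotent F E c N)) (g : (quasiSplit F E c N).Adelic), h ((u : (quasiSplit F E c N).Adelic) * g) = h g)
    (hf'N : ∀ (u : ↥(adelicUnipotent F E c N)) (g : (quasiSplit F E c N).Adelic), f' ((u : (quasiSplit F E c N).Adelic) * g) = f' g)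
    (hhB : ∀ b ∈ arithmeticBorel F E c N, ∀ x : (quasiSplit F E c N).Adelic, h ((b : (quasiSplit F E c N).Adelic) * x) = h x)
    (hf'B : ∀ b ∈ arithmeticBorel F E c N, ∀ x : (quasiSplit F E c N).Adelic, f' ((b : (quasiSplit F E c N).Adelic) * x) = f' x)
    (habs : ∫⁻ g, β g * ∫⁻ u : ↥(adelicUnipotent F E c N), ‖h ((quasiSplit F E c N).toAdelic (weylLongU (c : E →+* E) (rfl : (StdForm.antidiagonal N).over E = (StdForm.antidiagonal N).over E)) *
      ((u : (quasiSplit F E c N).Adelic) * g)) * (starRingEnd ℂ) (f' g)‖ₑ ∂νN ∂νG < ∞)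
    (habs' : ∫⁻ g, β g * ∫⁻ u : ↥(adelicUnipotent F E c N), ‖h g * (starRingEnd ℂ) (f' (((quasiSplit F E c N).toAdelic (weylLongU (c : E →+* E)
      (rfl : (StdForm.antidiagonal N).over E = (StdForm.antidiagonal N).over E)))⁻¹ * ((u : (quasiSplit F E c N).Adelic) * g)))‖ₑ ∂νN ∂νG < ∞) :
    ∫ g, (β g).toReal • ((∫ u : ↥(adelicUnipotent F E c N), h ((quasiSplit F E c N).toAdelic (weylLongU (c : E →+* E) (rfl : (StdForm.antidiagonal N).over E = (StdForm.antidiagonal N).over E)) *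
        ((u : (quasiSplit F E c N).Adelic) * g)) ∂νN) * (starRingEnd ℂ) (f' g)) ∂νG =
      ∫ g, (β g).toReal • (h g * (starRingEnd ℂ) (∫ u : ↥(adelicUnipotent F E c N), f' (((quasiSplit F E c N).toAdelic (weylLongU (c : E →+* E)
        (rfl : (StdForm.antidiagonal N).over E = (StdForm.antidiagonal N).over E)))⁻¹ * ((u : (quasiSplit F E c N).Adelic) * g)) ∂νN)) ∂νG := by
  haveI := secondCountableTopology_adeleRing E
  haveI := locallyCompactSpace_adeleRing' E
  haveI : SecondCountableTopology (quasiSplit F E c N).Adelic := inferInstanceAs (SecondCountableTopology (adelic F E c N ((StdForm.antidiagonal N).over E)))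
  haveI : LocallyCompactSpace (quasiSplit F E c N).Adelic := inferInstanceAs (LocallyCompactSpace (adelic F E c N ((StdForm.antidiagonal N).over E)))
  haveI : LocallyCompactSpace ↥(adelicUnipotent F E c N) := (isClosed_adelicUnipotent' (F := F) (E := E) (c := c) (N := N)).locallyCompactSpace
  haveI : SecondCountableTopology ↥(adelicUnipotent F E c N) := TopologicalSpace.Subtype.secondCountableTopology _
  haveI := countable_mapTorus (F := F) (E := E) (c := c) (N := N)
  haveI := countable_rationalUnipotent' (F := F) (E := E) (c := c) (N := N)
  haveI := K2E1IntertwiningAdjointEngine.measurableConstSMul_subgroup (rationalUnipotent F E c N)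
  haveI := K2E1IntertwiningAdjointEngine.smulInvariantMeasure_subgroup (rationalUnipotent F E c N) νN
  obtain ⟨e, he⟩ := exists_equiv_torus_prod_rationalUnipotent (F := F) (E := E) (c := c) (N := N)
  -- conjugation by `T(F)♯` preserves `N(𝔸)` and `ν_N`
  have htU : ∀ t ∈ (torusU (c : E →+* E) ((StdForm.antidiagonal N).over E)).map (quasiSplit F E c N).toAdelic, ∀ u : ↥(adelicUnipotent F E c N),
      t⁻¹ * (u : (quasiSplit F E c N).Adelic) * t ∈ adelicUnipotent F E c N := fun t ht u => by
    obtain ⟨t₀, ht₀, rfl⟩ := mem_mapTorus_iff.1 ht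
    exact conj_mem_adelicUnipotent ((K2E1PseudoEisensteinConstantTermU.toAdelic_mem_borelAdelic_iff t₀).2 (torusU_le_borelU _ _ ht₀)) u.2
  have hconj' : ∀ (t : (quasiSplit F E c N).Adelic) (ht : t ∈ (torusU (c : E →+* E) ((StdForm.antidiagonal N).over E)).map (quasiSplit F E c N).toAdelic)
      (f : ↥(adelicUnipotent F E c N) → ℝ≥0∞), Measurable f →
        ∫⁻ u, f ⟨t⁻¹ * (u : (quasiSplit F E c N).Adelic) * t, htU t ht u⟩ ∂νN = ∫⁻ u, f u ∂νN := by
    intro t ht f hf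
    obtain ⟨t₀, ht₀, ht⟩ := mem_mapTorus_iff.1 ht
    subst ht
    have hκ : Measurable fun u : ↥(adelicUnipotent F E c N) =>
        (⟨((quasiSplit F E c N).toAdelic t₀)⁻¹ * (u : (quasiSplit F E c N).Adelic) * (quasiSplit F E c N).toAdelic t₀, htU _ ht u⟩ : ↥(adelicUnipotent F E c N)) :=
      ((measurable_subtype_coe.const_mul _).mul_const _).subtype_mk
    have hmap : νN.map (fun u : ↥(adelicUnipotent F E c N) =>
        (⟨((quasiSplit F E c N).toAdelic t₀)⁻¹ * (u : (quasiSplit F E c N).Adelic) * (quasiSplit F E c N).toAdelic t₀, htU _ ht u⟩ : ↥(adelicUnipotent F E c N))) = νN :=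
      hconj t₀ (torusU_le_borelU _ _ ht₀)
    rw [← lintegral_map hf hκ, hmap]
  have hV := fun g => coveringSum_fibreWeight_eq (adelicUnipotent F E c N) νN ((arithmeticBorel F E c N).map (quasiSplit F E c N).arithmeticSubgroup.subtype)
    ((torusU (c : E →+* E) ((StdForm.antidiagonal N).over E)).map (quasiSplit F E c N).toAdelic) (rationalUnipotent F E c N) e he h𝓕 htU hconj' hβ g
  -- `w = ι w₀` normalises `T(F)♯`
  have hw0i : (weylLongU (c : E →+* E) (rfl : (StdForm.antidiagonal N).over E = (StdForm.antidiagonal N).over E))⁻¹ = weylLongU (c : E →+* E) rfl :=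
    inv_eq_of_mul_eq_one_right hww
  have hw : ∀ t ∈ (torusU (c : E →+* E) ((StdForm.antidiagonal N).over E)).map (quasiSplit F E c N).toAdelic,
      (quasiSplit F E c N).toAdelic (weylLongU (c : E →+* E) (rfl : (StdForm.antidiagonal N).over E = (StdForm.antidiagonal N).over E)) * t *
        ((quasiSplit F E c N).toAdelic (weylLongU (c : E →+* E) (rfl : (StdForm.antidiagonal N).over E = (StdForm.antidiagonal N).over E)))⁻¹ ∈
        (torusU (c : E →+* E) ((StdForm.antidiagonal N).over E)).map (quasiSplit F E c N).toAdelic := fun t ht => by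
    obtain ⟨t₀, ht₀, rfl⟩ := mem_mapTorus_iff.1 ht
    refine Subgroup.mem_map.2 ⟨_, hweyl t₀ ht₀, ?_⟩
    rw [toAdelic_mul_quasiSplit, toAdelic_mul_quasiSplit, ← map_inv]
    rfl
  have hw' : ∀ t ∈ (torusU (c : E →+* E) ((StdForm.antidiagonal N).over E)).map (quasiSplit F E c N).toAdelic,
      ((quasiSplit F E c N).toAdelic (weylLongU (c : E →+* E) (rfl : (StdForm.antidiagonal N).over E = (StdForm.antidiagonal N).over E)))⁻¹ * t *
        (quasiSplit F E c N).toAdelic (weylLongU (c : E →+* E) (rfl : (StdForm.antidiagonal N).over E = (StdForm.antidiagonal N).over E)) ∈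
        (torusU (c : E →+* E) ((StdForm.antidiagonal N).over E)).map (quasiSplit F E c N).toAdelic := fun t ht => by
    obtain ⟨t₀, ht₀, rfl⟩ := mem_mapTorus_iff.1 ht
    have key : (weylLongU (c : E →+* E) (rfl : (StdForm.antidiagonal N).over E = (StdForm.antidiagonal N).over E))⁻¹ * t₀ * weylLongU (c : E →+* E) rfl ∈
        torusU (c : E →+* E) ((StdForm.antidiagonal N).over E) := by
      have h1 := hweyl t₀ ht₀
      rw [hw0i] at h1 ⊢
      exact h1
    refine Subgroup.mem_map.2 ⟨_, key, ?_⟩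
    rw [toAdelic_mul_quasiSplit, toAdelic_mul_quasiSplit, ← map_inv]
    rfl
  -- `B(F)`-invariance restricted to `T(F)♯`
  have hhT : ∀ t ∈ (torusU (c : E →+* E) ((StdForm.antidiagonal N).over E)).map (quasiSplit F E c N).toAdelic, ∀ g : (quasiSplit F E c N).Adelic, h (t * g) = h g := fun t ht g => by
    obtain ⟨t₀, ht₀, rfl⟩ := mem_mapTorus_iff.1 ht
    exact hhB ⟨(quasiSplit F E c N).toAdelic t₀, t₀, rfl⟩ ((mem_arithmeticBorel_iff_of_toAdelic_eq rfl).2 (torusU_le_borelU _ _ ht₀)) g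
  have hf'T : ∀ t ∈ (torusU (c : E →+* E) ((StdForm.antidiagonal N).over E)).map (quasiSplit F E c N).toAdelic, ∀ g : (quasiSplit F E c N).Adelic, f' (t * g) = f' g := fun t ht g => by
    obtain ⟨t₀, ht₀, rfl⟩ := mem_mapTorus_iff.1 ht
    exact hf'B ⟨(quasiSplit F E c N).toAdelic t₀, t₀, rfl⟩ ((mem_arithmeticBorel_iff_of_toAdelic_eq rfl).2 (torusU_le_borelU _ _ ht₀)) g
  have hβfin : ∀ g, β g ≠ ∞ := fun g => ne_top_of_le_ne_top ENNReal.one_ne_top (hβ.le_one g)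
  exact integral_wt_smul_intertwining_mul_conj_eq νG (adelicUnipotent F E c N) νN ((torusU (c : E →+* E) ((StdForm.antidiagonal N).over E)).map (quasiSplit F E c N).toAdelic)
    hβ.measurable hβfin h𝓕₀ h𝓕top hV hw hw' hhm hf'm hhN hf'N hhT hf'T habs habs'

/-- **THE UNFOLDED MIDDLE FORM** (dealer's ask (a)): `⟨M_{ι w₀} h, f'⟩_B = ∫ g, wt B_β(g) • (h(ι w₀ g) · conj f'(g)) dν_G`, `B_β(g) = ∫⁻_{N(𝔸)} β(u⁻¹ g) dν_N` the fibre weight — i.e. the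
pairing read at the `T(F)∖G(𝔸)` level (★ engine (E1), `f'(u g) = f'(g)`).  Only the left absolute-convergence hypothesis is needed. [cite: MoeglinWaldspurger1995, II.1.8] [cite: Garrett2018, §1.10] -/
theorem integral_wt_smul_intertwining_mul_conj_eq_integral_fibreWeight
    (νG : Measure (quasiSplit F E c N).Adelic) [νG.IsHaarMeasure] (νN : Measure ↥(adelicUnipotent F E c N)) [νN.IsHaarMeasure]
    {β : (quasiSplit F E c N).Adelic → ℝ≥0∞} (hβ : IsCoveringWeight ↥((arithmeticBorel F E c N).map (quasiSplit F E c N).arithmeticSubgroup.subtype) β)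
    {h f' : (quasiSplit F E c N).Adelic → ℂ} (hhm : Measurable h) (hf'm : Measurable f')
    (hf'N : ∀ (u : ↥(adelicUnipotent F E c N)) (g : (quasiSplit F E c N).Adelic), f' ((u : (quasiSplit F E c N).Adelic) * g) = f' g) (w : (quasiSplit F E c N).Adelic)
    (habs : ∫⁻ g, β g * ∫⁻ u : ↥(adelicUnipotent F E c N), ‖h (w * ((u : (quasiSplit F E c N).Adelic) * g)) * (starRingEnd ℂ) (f' g)‖ₑ ∂νN ∂νG < ∞) :
    ∫ g, (β g).toReal • ((∫ u : ↥(adelicUnipotent F E c N), h (w * ((u : (quasiSplit F E c N).Adelic) * g)) ∂νN) * (starRingEnd ℂ) (f' g)) ∂νG =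
      ∫ g, (∫⁻ u : ↥(adelicUnipotent F E c N), β (((u : (quasiSplit F E c N).Adelic))⁻¹ * g) ∂νN).toReal • (h (w * g) * (starRingEnd ℂ) (f' g)) ∂νG := by
  haveI := secondCountableTopology_adeleRing E
  haveI := locallyCompactSpace_adeleRing' E
  haveI : SecondCountableTopology (quasiSplit F E c N).Adelic := inferInstanceAs (SecondCountableTopology (adelic F E c N ((StdForm.antidiagonal N).over E)))
  haveI : LocallyCompactSpace (quasiSplit F E c N).Adelic := inferInstanceAs (LocallyCompactSpace (adelic F E c N ((StdForm.antidiagonal N).over E)))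
  haveI : LocallyCompactSpace ↥(adelicUnipotent F E c N) := (isClosed_adelicUnipotent' (F := F) (E := E) (c := c) (N := N)).locallyCompactSpace
  haveI : SecondCountableTopology ↥(adelicUnipotent F E c N) := TopologicalSpace.Subtype.secondCountableTopology _
  have hβfin : ∀ g, β g ≠ ∞ := fun g => ne_top_of_le_ne_top ENNReal.one_ne_top (hβ.le_one g)
  have hΦm : Measurable fun y : (quasiSplit F E c N).Adelic => h (w * y) * (starRingEnd ℂ) (f' y) :=
    (hhm.comp (measurable_const_mul w)).mul (Complex.continuous_conj.measurable.comp hf'm)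
  have hL : ∀ g : (quasiSplit F E c N).Adelic, (∫ u : ↥(adelicUnipotent F E c N), h (w * ((u : (quasiSplit F E c N).Adelic) * g)) ∂νN) * (starRingEnd ℂ) (f' g) =
      ∫ u : ↥(adelicUnipotent F E c N), (fun y => h (w * y) * (starRingEnd ℂ) (f' y)) ((u : (quasiSplit F E c N).Adelic) * g) ∂νN := fun g => by
    rw [← integral_mul_const]
    exact integral_congr_ae (ae_of_all _ fun u => by simp only [hf'N u g])
  have habsL : ∫⁻ g, β g * ∫⁻ u : ↥(adelicUnipotent F E c N), ‖(fun y => h (w * y) * (starRingEnd ℂ) (f' y)) ((u : (quasiSplit F E c N).Adelic) * g)‖ₑ ∂νN ∂νG < ∞ := by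
    refine lt_of_le_of_lt (le_of_eq (lintegral_congr fun g => ?_)) habs
    congr 1; exact lintegral_congr fun u => by simp only [hf'N u g]
  simp_rw [hL]
  exact integral_wt_smul_integral_translate νG (adelicUnipotent F E c N) νN hβ.measurable hβfin hΦm habsL

end Adjoint

/-! ## §3 The rank-one instances `U(J₃)`, `U(J₂)` -/

section Instances

/-- **`⟨M_{ι(J₃)} h, f'⟩_B = ⟨h, M_{ι(J₃)⁻¹} f'⟩_B` on `U(J₃)(𝔸_F)`** (`c² = 1`, `c ≠ 1`): §2 with ★ `weylConj_mem_torusU`, ★ `weylLongU_mul_weylLongU`, ★ p857500 `map_conj_toAdelic_eq_self_three`.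
[cite: MoeglinWaldspurger1995, II.1.8] [cite: Garrett2018, §1.10–§1.11] -/
theorem integral_wt_smul_intertwining_mul_conj_eq_three {F E : Type} [Field F] [NumberField F] [Field E] [NumberField E] [Algebra F E] {c : E ≃ₐ[F] E}
    (hc : c * c = 1) (hc1 : c ≠ 1) [MeasurableSpace (quasiSplit F E c 3).Adelic] [BorelSpace (quasiSplit F E c 3).Adelic]
    (νG : Measure (quasiSplit F E c 3).Adelic) [νG.IsHaarMeasure] (νN : Measure ↥(adelicUnipotent F E c 3)) [νN.IsHaarMeasure] [νN.IsInvInvariant]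
    {β : (quasiSplit F E c 3).Adelic → ℝ≥0∞} (hβ : IsCoveringWeight ↥((arithmeticBorel F E c 3).map (quasiSplit F E c 3).arithmeticSubgroup.subtype) β)
    {𝓕 : Set ↥(adelicUnipotent F E c 3)} (h𝓕 : IsFundamentalDomain ↥(rationalUnipotent F E c 3) 𝓕 νN) (h𝓕₀ : νN 𝓕 ≠ 0) (h𝓕top : νN 𝓕 ≠ ∞)
    {h f' : (quasiSplit F E c 3).Adelic → ℂ} (hhm : Measurable h) (hf'm : Measurable f')
    (hhN : ∀ (u : ↥(adelicUnipotent F E c 3)) (g : (quasiSplit F E c 3).Adelic), h ((u : (quasiSplit F E c 3).Adelic) * g) = h g)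
    (hf'N : ∀ (u : ↥(adelicUnipotent F E c 3)) (g : (quasiSplit F E c 3).Adelic), f' ((u : (quasiSplit F E c 3).Adelic) * g) = f' g)
    (hhB : ∀ b ∈ arithmeticBorel F E c 3, ∀ x : (quasiSplit F E c 3).Adelic, h ((b : (quasiSplit F E c 3).Adelic) * x) = h x)
    (hf'B : ∀ b ∈ arithmeticBorel F E c 3, ∀ x : (quasiSplit F E c 3).Adelic, f' ((b : (quasiSplit F E c 3).Adelic) * x) = f' x)
    (habs : ∫⁻ g, β g * ∫⁻ u : ↥(adelicUnipotent F E c 3), ‖h ((quasiSplit F E c 3).toAdelic (weylLongU (c : E →+* E) (rfl : (StdForm.antidiagonal 3).over E = (StdForm.antidiagonal 3).over E)) *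
      ((u : (quasiSplit F E c 3).Adelic) * g)) * (starRingEnd ℂ) (f' g)‖ₑ ∂νN ∂νG < ∞)
    (habs' : ∫⁻ g, β g * ∫⁻ u : ↥(adelicUnipotent F E c 3), ‖h g * (starRingEnd ℂ) (f' (((quasiSplit F E c 3).toAdelic (weylLongU (c : E →+* E)
      (rfl : (StdForm.antidiagonal 3).over E = (StdForm.antidiagonal 3).over E)))⁻¹ * ((u : (quasiSplit F E c 3).Adelic) * g)))‖ₑ ∂νN ∂νG < ∞) :
    ∫ g, (β g).toReal • ((∫ u : ↥(adelicUnipotent F E c 3), h ((quasiSplit F E c 3).toAdelic (weylLongU (c : E →+* E) (rfl : (StdForm.antidiagonal 3).over E = (StdForm.antidiagonal 3).over E)) *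
        ((u : (quasiSplit F E c 3).Adelic) * g)) ∂νN) * (starRingEnd ℂ) (f' g)) ∂νG =
      ∫ g, (β g).toReal • (h g * (starRingEnd ℂ) (∫ u : ↥(adelicUnipotent F E c 3), f' (((quasiSplit F E c 3).toAdelic (weylLongU (c : E →+* E)
        (rfl : (StdForm.antidiagonal 3).over E = (StdForm.antidiagonal 3).over E)))⁻¹ * ((u : (quasiSplit F E c 3).Adelic) * g)) ∂νN)) ∂νG :=
  integral_wt_smul_intertwining_mul_conj_eq_of νG νN
    (fun t₀ ht₀ => weylConj_mem_torusU (c : E →+* E) rfl (weylLongU (c : E →+* E) rfl) (coe_coe_weylLongU (c : E →+* E) rfl) ⟨t₀, ht₀⟩)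
    (weylLongU_mul_weylLongU (c : E →+* E) rfl) (fun _ hb₀ => map_conj_toAdelic_eq_self_three hc hc1 νN hb₀) hβ h𝓕 h𝓕₀ h𝓕top hhm hf'm hhN hf'N hhB hf'B habs habs'

/-- **`⟨M_{ι(J₂)} h, f'⟩_B = ⟨h, M_{ι(J₂)⁻¹} f'⟩_B` on `U(J₂)(𝔸_F)`** (`c² = 1`, `c ≠ 1`): §2 with ★ `weylConj_mem_two`, §1 `weylLongU_mul_weylLongU_two`, ★ p857500 `map_conj_toAdelic_eq_self_two`.
[cite: MoeglinWaldspurger1995, II.1.8] [cite: Garrett2018, §1.10–§1.11] -/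
theorem integral_wt_smul_intertwining_mul_conj_eq_two {F E : Type} [Field F] [NumberField F] [Field E] [NumberField E] [Algebra F E] {c : E ≃ₐ[F] E}
    (hc : c * c = 1) (hc1 : c ≠ 1) [MeasurableSpace (quasiSplit F E c 2).Adelic] [BorelSpace (quasiSplit F E c 2).Adelic]
    (νG : Measure (quasiSplit F E c 2).Adelic) [νG.IsHaarMeasure] (νN : Measure ↥(adelicUnipotent F E c 2)) [νN.IsHaarMeasure] [νN.IsInvInvariant]
    {β : (quasiSplit F E c 2).Adelic → ℝ≥0∞} (hβ : IsCoveringWeight ↥((arithmeticBorel F E c 2).map (quasiSplit F E c 2).arithmeticSubgroup.subtype) β)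
    {𝓕 : Set ↥(adelicUnipotent F E c 2)} (h𝓕 : IsFundamentalDomain ↥(rationalUnipotent F E c 2) 𝓕 νN) (h𝓕₀ : νN 𝓕 ≠ 0) (h𝓕top : νN 𝓕 ≠ ∞)
    {h f' : (quasiSplit F E c 2).Adelic → ℂ} (hhm : Measurable h) (hf'm : Measurable f')
    (hhN : ∀ (u : ↥(adelicUnipotent F E c 2)) (g : (quasiSplit F E c 2).Adelic), h ((u : (quasiSplit F E c 2).Adelic) * g) = h g)
    (hf'N : ∀ (u : ↥(adelicUnipotent F E c 2)) (g : (quasiSplit F E c 2).Adelic), f' ((u : (quasiSplit F E c 2).Adelic) * g) = f' g)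
    (hhB : ∀ b ∈ arithmeticBorel F E c 2, ∀ x : (quasiSplit F E c 2).Adelic, h ((b : (quasiSplit F E c 2).Adelic) * x) = h x)
    (hf'B : ∀ b ∈ arithmeticBorel F E c 2, ∀ x : (quasiSplit F E c 2).Adelic, f' ((b : (quasiSplit F E c 2).Adelic) * x) = f' x)
    (habs : ∫⁻ g, β g * ∫⁻ u : ↥(adelicUnipotent F E c 2), ‖h ((quasiSplit F E c 2).toAdelic (weylLongU (c : E →+* E) (rfl : (StdForm.antidiagonal 2).over E = (StdForm.antidiagonal 2).over E)) *
      ((u : (quasiSplit F E c 2).Adelic) * g)) * (starRingEnd ℂ) (f' g)‖ₑ ∂νN ∂νG < ∞)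
    (habs' : ∫⁻ g, β g * ∫⁻ u : ↥(adelicUnipotent F E c 2), ‖h g * (starRingEnd ℂ) (f' (((quasiSplit F E c 2).toAdelic (weylLongU (c : E →+* E)
      (rfl : (StdForm.antidiagonal 2).over E = (StdForm.antidiagonal 2).over E)))⁻¹ * ((u : (quasiSplit F E c 2).Adelic) * g)))‖ₑ ∂νN ∂νG < ∞) :
    ∫ g, (β g).toReal • ((∫ u : ↥(adelicUnipotent F E c 2), h ((quasiSplit F E c 2).toAdelic (weylLongU (c : E →+* E) (rfl : (StdForm.antidiagonal 2).over E = (StdForm.antidiagonal 2).over E)) *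
        ((u : (quasiSplit F E c 2).Adelic) * g)) ∂νN) * (starRingEnd ℂ) (f' g)) ∂νG =
      ∫ g, (β g).toReal • (h g * (starRingEnd ℂ) (∫ u : ↥(adelicUnipotent F E c 2), f' (((quasiSplit F E c 2).toAdelic (weylLongU (c : E →+* E)
        (rfl : (StdForm.antidiagonal 2).over E = (StdForm.antidiagonal 2).over E)))⁻¹ * ((u : (quasiSplit F E c 2).Adelic) * g)) ∂νN)) ∂νG :=
  integral_wt_smul_intertwining_mul_conj_eq_of νG νN
    (fun t₀ ht₀ => (weylConj_mem_two (c : E →+* E) rfl (weylLongU (c : E →+* E) rfl) (coe_coe_weylLongU (c : E →+* E) rfl) ⟨t₀, ht₀⟩).1)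
    (weylLongU_mul_weylLongU_two (c : E →+* E)) (fun _ hb₀ => map_conj_toAdelic_eq_self_two hc hc1 νN hb₀) hβ h𝓕 h𝓕₀ h𝓕top hhm hf'm hhN hf'N hhB hf'B habs habs'

end Instances

end Summit.HodgeConjecture.HodgeConjecture.Cruxes.H413.K2E1IntertwiningAdjoint

end
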